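import Summits.NavierStokesRegularity.NavierStokesRegularity.Theorems.TerminalTraceTypeITraceScarL3StrongExtinction
import Mathlib.Analysis.Calculus.BumpFunction.InnerProduct
import Mathlib.Analysis.Calculus.ContDiff.Bounds
import HarnessLib

/-!
# Assembly tools for ROUND-27 «THE √2 APEX» (T27-A′): the radial cut-off with uniform derivative bounds, and
# strong extinction of the cut-off energy along a continuous representative
# (item `TerminalTrace.TypeITraceScarL3`, stmt-NavierStokesRegularity-18385, Stub LOUD line; helpers)

Seat nsreg-C26-p1 g2 (cell ns-regularity-ideate), `--supports stmt-NavierStokesRegularity-18385` (helper).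

* `exists_cutoff_with_bounds` — for `0 < ρ₁ < ρ₂` a smooth `φ : ℝ³ → [0,1]`, `φ = 1` on `|y| ≤ ρ₁`, `φ = 0` on
  `|y| ≥ ρ₂`, with `‖Dⁱφ‖ ≤ M_φ` (`i ≤ 3`) and `‖Dφ‖ ≤ C_φ` everywhere (Mathlib `ContDiffBump`; continuity and
  compact support of the derivatives).
* `le_of_ae_le_of_continuousOn_Ioo` — a function continuous on an open interval and `≤ η` a.e. there is
  `≤ η` everywhere there.
* `tendsto_cutoffEnergy_zero` — STRONG EXTINCTION for the cut-off energy of a continuous representative: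
  if `(U, P)` is an extinct Type-I apex package (suitable in every `Q(a)`, `𝐈 ≤ M`, `D ≤ D₀`, weakly null
  top; tree `strongExtinction`), `U = V` a.e. on the lower slab, `0 ≤ φ ≤ 1` vanishes on `|y| ≥ ρ₂`, and
  `E(s) = ∫ ‖φV(s)‖²` is continuous on some `]s₁, 0[`, then `E(s) → 0` as `s → 0⁻`.

WHAT THIS IS NOT: not T27-A, not NS regularity — bookkeeping.  [folklore; CaffarelliKohnNirenberg1982 Thm B]
-/

noncomputable section

set_option linter.dupNamespace false

namespace Summit.NavierStokesRegularity.NavierStokesRegularity.Theorems.TypeITraceScarL3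

open MeasureTheory Set Function Filter Topology Metric InnerProductSpace
open Literature.Analysis.FluidPDE
open scoped NNReal ENNReal RealInnerProductSpace ContDiff

/-! ### The cut-off -/

/-- **A radial cut-off with uniform derivative bounds** (module docstring). [folklore] -/
theorem exists_cutoff_with_bounds {ρ₁ ρ₂ : ℝ} (hρ₁ : 0 < ρ₁) (hρ₁₂ : ρ₁ < ρ₂) :
    ∃ (φ : EuclideanSpace ℝ (Fin 3) → ℝ) (Mφ Cφ : ℝ), ContDiff ℝ ∞ φ ∧ HasCompactSupport φ ∧
      (∀ y, ‖y‖ ≤ ρ₁ → φ y = 1) ∧ (∀ y, ρ₂ ≤ ‖y‖ → φ y = 0) ∧ (∀ y, 0 ≤ φ y ∧ φ y ≤ 1) ∧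
      0 ≤ Mφ ∧ 0 ≤ Cφ ∧ (∀ y, ∀ i ≤ 3, ‖iteratedFDeriv ℝ i φ y‖ ≤ Mφ) ∧ (∀ y, ‖fderiv ℝ φ y‖ ≤ Cφ) := by
  let f : ContDiffBump (0 : EuclideanSpace ℝ (Fin 3)) := ⟨ρ₁, ρ₂, hρ₁, hρ₁₂⟩
  have hf : ContDiff ℝ ∞ (f : EuclideanSpace ℝ (Fin 3) → ℝ) := f.contDiff
  have hfc : HasCompactSupport (f : EuclideanSpace ℝ (Fin 3) → ℝ) := f.hasCompactSupport
  -- bounds on the derivatives of order `≤ 3`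
  have hbd : ∀ i : ℕ, ∃ C : ℝ, ∀ y, ‖iteratedFDeriv ℝ i (f : EuclideanSpace ℝ (Fin 3) → ℝ) y‖ ≤ C := fun i =>
    (hf.continuous_iteratedFDeriv (m := i) (by exact_mod_cast le_top)).bounded_above_of_compact_support
      (hfc.iteratedFDeriv i)
  obtain ⟨C0, hC0⟩ := hbd 0
  obtain ⟨C1, hC1⟩ := hbd 1
  obtain ⟨C2, hC2⟩ := hbd 2
  obtain ⟨C3, hC3⟩ := hbd 3
  obtain ⟨Cd, hCd⟩ := (hf.continuous_fderiv (by simp)).bounded_above_of_compact_support (hfc.fderiv (𝕜 := ℝ))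
  refine ⟨f, max (max (max C0 C1) (max C2 C3)) 0, max Cd 0, hf, hfc, fun y hy => ?_, fun y hy => ?_,
    fun y => ⟨f.nonneg, f.le_one⟩, le_max_right _ _, le_max_right _ _, fun y i hi => ?_,
    fun y => (hCd y).trans (le_max_left _ _)⟩
  · exact f.one_of_mem_closedBall (by rw [mem_closedBall_zero_iff]; exact hy)
  · exact f.zero_of_le_dist (by rw [dist_zero_right]; exact hy)
  · interval_cases i
    · exact (hC0 y).trans ((le_max_left _ _).trans ((le_max_left _ _).trans (le_max_left _ _)))
    · exact (hC1 y).trans ((le_max_right _ _).trans ((le_max_left _ _).trans (le_max_left _ _)))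
    · exact (hC2 y).trans ((le_max_left _ _).trans ((le_max_right _ _).trans (le_max_left _ _)))
    · exact (hC3 y).trans ((le_max_right _ _).trans ((le_max_right _ _).trans (le_max_left _ _)))

/-! ### From a.e. to everywhere along a continuous function -/

/-- A function continuous on an open interval and `≤ η` a.e. there is `≤ η` everywhere there. [folklore] -/
theorem le_of_ae_le_of_continuousOn_Ioo {g : ℝ → ℝ} {a b η : ℝ} (hg : ContinuousOn g (Ioo a b))
    (hae : ∀ᵐ s ∂(volume.restrict (Ioo a b)), g s ≤ η) : ∀ s ∈ Ioo a b, g s ≤ η := by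
  intro s hs
  by_contra hlt
  rw [not_le] at hlt
  set N : Set ℝ := Ioo a b ∩ g ⁻¹' Ioi η with hN
  have hNopen : IsOpen N := hg.isOpen_inter_preimage isOpen_Ioo isOpen_Ioi
  have hsN : s ∈ N := ⟨hs, hlt⟩
  have hNpos : 0 < volume N := hNopen.measure_pos volume ⟨s, hsN⟩
  have hNzero : volume N = 0 := by
    have h1 : ∀ᵐ t ∂(volume : Measure ℝ), t ∈ Ioo a b → g t ≤ η := (ae_restrict_iff' measurableSet_Ioo).1 hae
    refine measure_mono_null (fun t htN => ?_) (ae_iff.1 h1)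
    intro ht
    have h2 : η < g t := htN.2
    exact absurd (ht htN.1) (not_le.2 h2)
  exact absurd hNzero hNpos.ne'

/-! ### Strong extinction of the cut-off energy -/

/-- **`E(s) = ∫ ‖φV(s)‖² → 0` as `s → 0⁻`** for a continuous representative of an extinct Type-I apex
(module docstring). [folklore; CaffarelliKohnNirenberg1982 Thm B; tree `strongExtinction`] -/
theorem tendsto_cutoffEnergy_zero
    {U V : ℝ → EuclideanSpace ℝ (Fin 3) → EuclideanSpace ℝ (Fin 3)}
    {P : ℝ → EuclideanSpace ℝ (Fin 3) → ℝ}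
    {G : ℝ → EuclideanSpace ℝ (Fin 3) → EuclideanSpace ℝ (Fin 3) →L[ℝ] EuclideanSpace ℝ (Fin 3)}
    {M D₀ : ℝ≥0}
    (hsw : ∀ a : ℝ, 0 < a →
      IsSuitableWeakSolutionInBall a (0 : ℝ × EuclideanSpace ℝ (Fin 3)) U P)
    (hI : ∀ a : ℝ, 0 < a →
      typeIBound (parabolicCylinder a (0 : ℝ × EuclideanSpace ℝ (Fin 3))) U P G ≤ M)
    (hD : ∀ z₀ : ℝ × EuclideanSpace ℝ (Fin 3), z₀.1 ≤ 0 →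
      ∀ r : ℝ, 0 < r → cknD r z₀ P ≤ D₀)
    (htop : ∀ φ : EuclideanSpace ℝ (Fin 3) → EuclideanSpace ℝ (Fin 3),
      ContDiff ℝ (⊤ : ℕ∞) φ →
      HasCompactSupport φ → ∀ ε : ℝ, 0 < ε →
      ∃ s₀ : ℝ, s₀ < 0 ∧ ∀ᵐ s ∂(volume.restrict (Ioo s₀ 0)), |∫ y, ⟪U s y, φ y⟫| ≤ ε)
    (hUV : ∀ᵐ s ∂(volume.restrict (Iio (0 : ℝ))), ∀ᵐ y : EuclideanSpace ℝ (Fin 3), U s y = V s y)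
    {φ : EuclideanSpace ℝ (Fin 3) → ℝ} {ρ₂ s₁ : ℝ} (hφ01 : ∀ y, 0 ≤ φ y ∧ φ y ≤ 1)
    (hφ0 : ∀ y : EuclideanSpace ℝ (Fin 3), ρ₂ ≤ ‖y‖ → φ y = 0) (hs₁ : s₁ < 0)
    (hEint : ∀ s ∈ Ioo s₁ 0, Integrable (fun y => ‖φ y • V s y‖ ^ 2)
      (volume : Measure (EuclideanSpace ℝ (Fin 3))))
    (hEc : ContinuousOn (fun s => ∫ y, ‖φ y • V s y‖ ^ 2) (Ioo s₁ 0)) :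
    Tendsto (fun s => ∫ y, ‖φ y • V s y‖ ^ 2) (𝓝[<] 0) (𝓝 0) := by
  -- for every `η > 0`, eventually `E ≤ η`
  have hev : ∀ η : ℝ, 0 < η → ∃ s₀ : ℝ, s₀ < 0 ∧ ∀ s ∈ Ioo s₀ 0, ∫ y, ‖φ y • V s y‖ ^ 2 ≤ η := by
    intro η hη
    obtain ⟨s₀, hs₀, hae⟩ := strongExtinction hsw hI hD htop ρ₂ hη
    refine ⟨max s₀ s₁, max_lt hs₀ hs₁, ?_⟩
    have hsub : Ioo (max s₀ s₁) 0 ⊆ Ioo s₀ 0 := Ioo_subset_Ioo (le_max_left _ _) le_rfl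
    have hsub' : Ioo (max s₀ s₁) 0 ⊆ Ioo s₁ 0 := Ioo_subset_Ioo (le_max_right _ _) le_rfl
    refine le_of_ae_le_of_continuousOn_Ioo (hEc.mono hsub') ?_
    have h1 : ∀ᵐ s ∂(volume.restrict (Ioo (max s₀ s₁) 0)),
        ∫⁻ z in ball (0 : EuclideanSpace ℝ (Fin 3)) ρ₂, ‖U s z‖ₑ ^ 2 ≤ ENNReal.ofReal η :=
      ae_restrict_of_ae_restrict_of_subset hsub hae
    have h2 : ∀ᵐ s ∂(volume.restrict (Ioo (max s₀ s₁) 0)), ∀ᵐ y : EuclideanSpace ℝ (Fin 3), U s y = V s y :=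
      ae_restrict_of_ae_restrict_of_subset (fun s hs => hs.2) hUV
    filter_upwards [h1, h2, ae_restrict_mem measurableSet_Ioo] with s hs1 hs2 hs
    -- `E(s) = ∫ φ²|V|² ≤ ∫_{B(0,ρ₂)} |V|² = ∫_{B(0,ρ₂)} |U|² ≤ η`
    have hle : ∫⁻ y, ‖φ y • V s y‖ₑ ^ 2 ≤ ∫⁻ z in ball (0 : EuclideanSpace ℝ (Fin 3)) ρ₂, ‖U s z‖ₑ ^ 2 := by
      have e1 : ∫⁻ z in ball (0 : EuclideanSpace ℝ (Fin 3)) ρ₂, ‖U s z‖ₑ ^ 2 =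
          ∫⁻ z in ball (0 : EuclideanSpace ℝ (Fin 3)) ρ₂, ‖V s z‖ₑ ^ 2 := by
        refine lintegral_congr_ae ?_
        filter_upwards [ae_restrict_of_ae hs2] with y hy
        rw [hy]
      rw [e1, ← lintegral_indicator measurableSet_ball]
      refine lintegral_mono fun y => ?_
      by_cases hy : y ∈ ball (0 : EuclideanSpace ℝ (Fin 3)) ρ₂
      · rw [indicator_of_mem hy]
        have h01 := hφ01 y
        have hn : ‖φ y • V s y‖ ≤ ‖V s y‖ := by
          rw [norm_smul, Real.norm_of_nonneg h01.1]
          exact mul_le_of_le_one_left (norm_nonneg _) h01.2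
        calc ‖φ y • V s y‖ₑ ^ 2 = ENNReal.ofReal (‖φ y • V s y‖ ^ 2) := by
              rw [← ofReal_norm, ENNReal.ofReal_pow (norm_nonneg _)]
          _ ≤ ENNReal.ofReal (‖V s y‖ ^ 2) :=
              ENNReal.ofReal_le_ofReal (pow_le_pow_left₀ (norm_nonneg _) hn 2)
          _ = ‖V s y‖ₑ ^ 2 := by rw [← ofReal_norm, ENNReal.ofReal_pow (norm_nonneg _)]
      · rw [indicator_of_notMem hy]
        rw [mem_ball_zero_iff, not_lt] at hy
        rw [hφ0 y hy, zero_smul]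
        simp
    have hfin : ENNReal.ofReal (∫ y, ‖φ y • V s y‖ ^ 2) ≤ ENNReal.ofReal η := by
      rw [ofReal_integral_eq_lintegral_ofReal (hEint s ⟨lt_of_le_of_lt (le_max_right _ _) hs.1, hs.2⟩)
        (Eventually.of_forall fun y => sq_nonneg _)]
      refine le_trans (le_of_eq (lintegral_congr fun y => ?_)) (hle.trans hs1)
      rw [← ofReal_norm, ENNReal.ofReal_pow (norm_nonneg _)]
    exact (ENNReal.ofReal_le_ofReal_iff hη.le).1 hfin
  -- conclude
  rw [tendsto_order]
  refine ⟨fun a ha => Eventually.of_forall fun s => lt_of_lt_of_le ha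
      (integral_nonneg fun y => sq_nonneg _), fun b hb => ?_⟩
  obtain ⟨s₀, hs₀, h⟩ := hev (b / 2) (half_pos hb)
  filter_upwards [Ioo_mem_nhdsLT hs₀] with s hs
  exact lt_of_le_of_lt (h s hs) (half_lt_self hb)

end Summit.NavierStokesRegularity.NavierStokesRegularity.Theorems.TypeITraceScarL3

end
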